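import Literature.AlgebraicGeometry.HodgeTheory.AbelianVarietyUniformisationPicard
import Literature.Geometry.Kaehler.ComplexTorusPicardPullback
import HarnessLib

/-!
# `𝒪_A(u^* D)^an = (u^an)^* 𝒪_{A′}(D)^an` for a homomorphism `u : A → A′` of uniformised complex abelian varieties
# ([Görtz–Wedhorn I] Def. 11.49 / Prop. 11.50 (p. 315) «`g^*𝒪_Y(D) ≅ 𝒪_X(g^*D)`»; [Lange 2023] §1.3.3 Lemma 1.3.6; [Serre GAGA] §2)

Topic `AlgebraicGeometry/HodgeTheory`; namespace `Literature.AlgebraicGeometry.HodgeTheory`.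
KERNEL ONLY: theorems; no definition, no named fact, no instance, no `sorry`.

The tree has the TRANSLATION case (★ `cartierDivisorLineBundle_pullback_translation`: `𝒪_A(t_x^*D)^an = (t^an)^*𝒪_A(D)^an` on
the nose) and the cocycle version for general morphisms of Hodge models (★
`HodgeModel.coordChange_cartierDivisorCocycle_pullback`).  This file records the HOMOMORPHISM case in the holomorphic-line-bundle
currency of the uniformisation picture (★ `cartierDivisorLineBundle`, ★ `ComplexTorus.mapMatrix`, ★ `picClass`; arbitrary
finite-dimensional model spaces `E`, `E′`, e.g. the charts `Ψ : ℝ^{2g} ≃ ℂ^g` of ★ `SiegelAdelicMarking`): if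
`u : A ⟶ A′` is a (dominant) homomorphism of complex abelian varieties with uniformisations `φ : V/Λ → A(ℂ)`, `φ′ : V′/Λ′ → A′(ℂ)`
and `u(ℂ) ∘ φ = φ′ ∘ (M·)` for an integer matrix `M` (★ GAGA `Motives.AbelianVariety.exists_mem_homInt_map_eq` produces such
`M`), then

* `cartierDivisorLineBundle_pullback_hom` — `𝒪_A(u^*D)^an = (M·)^* 𝒪_{A′}(D)^an` ON THE NOSE (same trivialising sets
  `φ(s̄) ∈ u⁻¹U_i ⟺ φ′(M s̄) ∈ U_i`, same transition functions ★ `CartierDivisor.evalOrZero_transFun_pullback`);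
* `picClass_cartierDivisorLineBundle_pullback_hom` — hence `[𝒪_A(u^*D)^an] = f^*[𝒪_{A′}(D)^an]` in `Pic(V/Λ)` for the
  pull-back `Pic.pullback Φ Φ′ hF` of [Lange 2023] Lemma 1.3.6 (★ `picClass_pullback_mapMatrix`), `F` the `ℂ`-linear
  analytic representation.

## References
* [GortzWedhorn2020] U. Görtz, T. Wedhorn, *Algebraic Geometry I*, 2nd ed. (2020), Def. 11.49 and Prop. 11.50 (p. 315).
* [Lange2023AbelianVarietiesComplex] H. Lange, *Abelian Varieties over the Complex Numbers* (2023), §1.3.3 Lemma 1.3.6 (p. 32),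
  §1.1.2 Prop. 1.1.6 (p. 8).
* [SerreGAGA1956] J.-P. Serre, GAGA, Ann. Inst. Fourier 6 (1956), §2 (fonctorialité).
HC_CM is proved only modulo the 7 printed citations until rung 0 closes; this file discharges none of them.
-/

set_option autoImplicit false

noncomputable section

open Set Function AlgebraicGeometry CategoryTheory
open scoped Manifold ContDiff Topology
open Literature.AlgebraicGeometry.Motives Literature.Geometry.Kaehler Literature.Geometry.Kaehler.ComplexTorus
open Literature.NumberTheory.Transcendental

namespace Literature.AlgebraicGeometry.HodgeTheory

/-- Two holomorphic line bundles with the same trivialising sets and the same transition functions are equal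
(the remaining fields are propositions; private helper). [folklore] -/
private theorem holomorphicLineBundle_ext_of_baseSet_coordChange'
    {κ : Type*} {E : Type*} [NormedAddCommGroup E] [NormedSpace ℂ E] {M : Type*} [TopologicalSpace M]
    [ChartedSpace E M] {L L' : HolomorphicLineBundle κ E M} (h₁ : L.baseSet = L'.baseSet)
    (h₂ : L.coordChange = L'.coordChange) : L = L' := by
  cases L; cases L'; cases h₁; cases h₂; rfl

variable {ι ι' : Type} [Fintype ι] [Fintype ι'] {E E' : Type} [NormedAddCommGroup E] [NormedSpace ℂ E]
  [FiniteDimensional ℂ E] [NormedAddCommGroup E'] [NormedSpace ℂ E'] [FiniteDimensional ℂ E'] {A A' : AbelianVariety ℂ}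
  {Φ : (ι → ℝ) ≃L[ℝ] E} {Φ' : (ι' → ℝ) ≃L[ℝ] E'}
  {φ : ComplexTorus Φ → ComplexPoints A.X} {φ' : ComplexTorus Φ' → ComplexPoints A'.X}
  (hφ : IsAnalytification E A.X A.dim φ) (hφ' : IsAnalytification E' A'.X A'.dim φ')

/-- **`𝒪_A(u^*D)^an = (M·)^* 𝒪_{A′}(D)^an` on the nose** for a dominant homomorphism `u : A ⟶ A′` whose action on complex
points is covered by the torus map `s̄ ↦ M s̄` (`φ′(M s̄) = u(φ(s̄))`): same trivialising sets (`φ(s̄) ∈ u⁻¹U_i ⟺ φ′(M s̄) ∈ U_i`)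
and same transition functions (★ `CartierDivisor.evalOrZero_transFun_pullback`).
[cite: GortzWedhorn2020, Def. 11.49 and Prop. 11.50 (p. 315)] [cite: Lange2023AbelianVarietiesComplex, §1.3.3 Lemma 1.3.6, p. 32] -/
theorem cartierDivisorLineBundle_pullback_hom (u : A ⟶ A') [IsDominant u.hom.hom.hom.left] (M : Matrix ι' ι ℤ)
    (hM : ∀ x, φ' (mapMatrix Φ Φ' M x) = AlgPoints.map u.hom.hom.hom (φ x))
    (hdiff : MDifferentiable 𝓘(ℂ, E) 𝓘(ℂ, E') (mapMatrix Φ Φ' M))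
    (D : CartierDivisor A'.X.left) :
    cartierDivisorLineBundle hφ (D.pullback u.hom.hom.hom.left) =
      (cartierDivisorLineBundle hφ' D).pullback (mapMatrix Φ Φ' M) hdiff := by
  refine holomorphicLineBundle_ext_of_baseSet_coordChange' ?_ ?_
  · funext i
    ext s
    show u.hom.hom.hom.left (φ s).pt ∈ D.U i ↔ (φ' (mapMatrix Φ Φ' M s)).pt ∈ D.U i
    rw [hM, AlgPoints.pt_map]
  · funext i j s
    show AlgPoints.evalOrZero ((D.pullback u.hom.hom.hom.left).U j ⊓ (D.pullback u.hom.hom.hom.left).U i)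
        ((D.pullback u.hom.hom.hom.left).transFun j i) (φ s) =
      AlgPoints.evalOrZero (D.U j ⊓ D.U i) (D.transFun j i) (φ' (mapMatrix Φ Φ' M s))
    rw [CartierDivisor.evalOrZero_transFun_pullback, hM]

/-- **`[𝒪_A(u^*D)^an] = f^*[𝒪_{A′}(D)^an]` in `Pic(V/Λ)`** ([Lange 2023] Lemma 1.3.6's pull-back `Pic.pullback Φ Φ′ hF` along
the homomorphism with rational representation `M` and `ℂ`-linear analytic representation `F`, ★ `picClass_pullback_mapMatrix`,
applied to `cartierDivisorLineBundle_pullback_hom`). [cite: Lange2023AbelianVarietiesComplex, §1.3.3 Lemma 1.3.6, p. 32]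
[cite: GortzWedhorn2020, Prop. 11.50 (p. 315)] -/
theorem picClass_cartierDivisorLineBundle_pullback_hom (u : A ⟶ A') [IsDominant u.hom.hom.hom.left] (M : Matrix ι' ι ℤ)
    {F : E →L[ℂ] E'} (hF : ∀ x, Φ' ((M.map (Int.cast : ℤ → ℝ)).mulVec x) = F (Φ x))
    (hM : ∀ x, φ' (mapMatrix Φ Φ' M x) = AlgPoints.map u.hom.hom.hom (φ x))
    (D : CartierDivisor A'.X.left) :
    picClass (cartierDivisorLineBundle hφ (D.pullback u.hom.hom.hom.left)) =
      Pic.pullback Φ Φ' hF (picClass (cartierDivisorLineBundle hφ' D)) := by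
  rw [cartierDivisorLineBundle_pullback_hom hφ hφ' u M hM (mdifferentiable_mapMatrix_of_analyticRep Φ Φ' hF) D]
  exact picClass_pullback_mapMatrix Φ Φ' hF _ _

end Literature.AlgebraicGeometry.HodgeTheory

end
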